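import Summits.QuantumFields.GaugeBoot.Targets
import Literature.MathematicalPhysics.QuantumFieldTheory.WilsonEnergyConvexity
import HarnessLib

/-!
# Gauge-boot: the monotone envelope and the free-energy corollary (A17)

Cell `pub-gaugeboot`, task L0, file 2/4 (theorems only; imports `Targets`).

HONEST FRAMING (page 1 of every file of this cell): certified bounds on lattice expectations at
STATED coupling, gauge group, dimension and torus size; NOT a mass gap, NOT a continuum limit,
NOT a string tension, NOT large `N`. The venture is explicitly NOT Yang–Mills-summit-bearing
(barriers `FixedCouplingUltralocality`, `PerturbativeInvisibility`: fixed-coupling ultralocal data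
say nothing about `a → 0`).

On every finite torus `(ℤ/L)^d`, for every compact `G` and continuous `ρ`:
* `⟨ū_P⟩_β = 1 - ⟨S⟩_β/(N·#plaquettes)` (`wilsonExpectation_meanPlaquette_eq`);
* `β ↦ ⟨ū_P⟩_β` is **non-decreasing on `ℝ`** (`monotone_wilsonExpectation_meanPlaquette`), from the
  tree theorem `wilsonExpectation_wilsonAction_antitone` (`WilsonEnergyConvexity`);
* the **free-energy bracket** `N·#P·(β'-β)·(⟨ū_P⟩_β - 1) ≤ log Z(β') - log Z(β) ≤
  N·#P·(β'-β)·(⟨ū_P⟩_{β'} - 1)` for all real `β, β'` (`torusLogPartition_sub_mem_Icc`), from the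
  tree's supporting-line inequality `mul_wilsonExpectation_wilsonAction_le`.

Consequences for certified windows (SCOPING Amendment 2, A17; zero compute): a certified LOWER
bound at `β_std` holds at every `β' ≥ β_std`, an UPPER bound at every `β' ≤ β_std`
(`PlaquetteWindow.lower_of_le`, `PlaquetteWindow.upper_of_ge`); two windows of one `(N, D)` family
must be consistent (`PlaquetteWindow.le_of_le`; a violation is kill trigger K10); and two windows at
`β₁ ≤ β₂` bracket the torus free-energy difference per plaquette at the tree couplings `βᵢ/N`
(`PlaquetteWindow.torusLogPartition_sub_mem_Icc`) — a statement at the two stated couplings,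
complementary to (not a substitute for) the `β → ∞` free-energy asymptotics in print.
-/

noncomputable section

open MeasureTheory Filter Topology
open Literature.MathematicalPhysics.QuantumFieldTheory
open Literature.MathematicalPhysics.QuantumLattice (fundamentalRep continuous_fundamentalRep
  LGConfig plaquetteObs plaquetteHolonomyZd torusLift toTorusObservable IsCylinder
  IsInfiniteVolumeLimitAlong torusLogPartition)
open Literature.RepresentationTheory.CompactGroups

namespace Summit.QuantumFields.GaugeBoot

section General

variable {d L N : ℕ} {G : Type*} [Group G] [TopologicalSpace G] [IsTopologicalGroup G]
  [CompactSpace G] [MeasurableSpace G] [BorelSpace G] (ρ : G →* Matrix (Fin N) (Fin N) ℂ)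

/-- **`⟨ū_P⟩_β = 1 - ⟨S⟩_β/(N · #plaquettes)`** in the finite-volume Wilson theory (continuous `ρ`,
`N ≥ 1`). [folklore] -/
theorem wilsonExpectation_meanPlaquette_eq [NeZero L] [Nonempty (Plaquette d L)] (hρ : Continuous ρ)
    (hN : N ≠ 0) (β : ℝ) :
    wilsonExpectation ρ β (meanPlaquette (d := d) (L := L) (G := G) ρ) =
      1 - wilsonExpectation ρ β (wilsonAction (d := d) (L := L) (G := G) ρ) /
        (N * Fintype.card (Plaquette d L)) := by
  haveI := isProbabilityMeasure_wilsonMeasure (d := d) (L := L) (G := G) ρ hρ β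
  have hfun : meanPlaquette (d := d) (L := L) (G := G) ρ =
      fun U => 1 - wilsonAction ρ U / (N * Fintype.card (Plaquette d L)) :=
    funext fun U => meanPlaquette_eq ρ hN U
  unfold wilsonExpectation
  rw [hfun, integral_sub (integrable_const _) ((integrable_wilsonAction ρ hρ _).div_const _),
    integral_const, probReal_univ, one_smul, integral_div]

/-- **Monotone envelope (A17)**: on every finite torus `β ↦ ⟨ū_P⟩_β` is non-decreasing on `ℝ`
(the mean action is non-increasing, tree theorem `wilsonExpectation_wilsonAction_antitone`; for
`N = 0` or a torus without plaquettes `ū_P ≡ 0`). [folklore] -/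
theorem monotone_wilsonExpectation_meanPlaquette [NeZero L] (hρ : Continuous ρ) :
    Monotone fun β : ℝ => wilsonExpectation ρ β (meanPlaquette (d := d) (L := L) (G := G) ρ) := by
  rcases isEmpty_or_nonempty (Plaquette d L) with hP | hP
  · have h0 : meanPlaquette (d := d) (L := L) (G := G) ρ = fun _ => 0 := by
      funext U; simp [meanPlaquette]
    simp only [h0, wilsonExpectation, integral_zero]
    exact monotone_const
  rcases Nat.eq_zero_or_pos N with hN | hN
  · subst hN
    have h0 : meanPlaquette (d := d) (L := L) (G := G) ρ = fun _ => 0 := by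
      funext U; simp [meanPlaquette, plaquetteTrace]
    simp only [h0, wilsonExpectation, integral_zero]
    exact monotone_const
  intro β β' hle
  simp only [wilsonExpectation_meanPlaquette_eq ρ hρ hN.ne']
  have hanti : wilsonExpectation ρ β' (wilsonAction (d := d) (L := L) (G := G) ρ) ≤
      wilsonExpectation ρ β (wilsonAction (d := d) (L := L) (G := G) ρ) :=
    wilsonExpectation_wilsonAction_antitone (d := d) (L := L) (G := G) ρ hρ hle
  have hpos : (0 : ℝ) < N * Fintype.card (Plaquette d L) := by
    have h1 : (0 : ℝ) < N := by exact_mod_cast hN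
    have h2 : (0 : ℝ) < Fintype.card (Plaquette d L) := by exact_mod_cast Fintype.card_pos
    positivity
  have := div_le_div_of_nonneg_right hanti hpos.le
  linarith

/-- **Free-energy corollary (A17)**: for all real `β, β'` (tree couplings) on every finite torus,
`N·#P·(β'-β)·(⟨ū_P⟩_β - 1) ≤ log Z(β') - log Z(β) ≤ N·#P·(β'-β)·(⟨ū_P⟩_{β'} - 1)` — the two
supporting-line inequalities `mul_wilsonExpectation_wilsonAction_le` rewritten through
`⟨S⟩ = N·#P·(1 - ⟨ū_P⟩)` (no order between `β` and `β'` is needed). [folklore] -/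
theorem torusLogPartition_sub_mem_Icc [NeZero L] [Nonempty (Plaquette d L)] (hρ : Continuous ρ)
    (hN : N ≠ 0) (β β' : ℝ) :
    torusLogPartition d ρ β' L - torusLogPartition d ρ β L ∈ Set.Icc
      (N * Fintype.card (Plaquette d L) * (β' - β) *
        (wilsonExpectation ρ β (meanPlaquette (d := d) (L := L) (G := G) ρ) - 1))
      (N * Fintype.card (Plaquette d L) * (β' - β) *
        (wilsonExpectation ρ β' (meanPlaquette (d := d) (L := L) (G := G) ρ) - 1)) := by
  have hP : (0 : ℝ) < N * Fintype.card (Plaquette d L) := by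
    have h1 : (0 : ℝ) < N := by exact_mod_cast Nat.pos_of_ne_zero hN
    have h2 : (0 : ℝ) < Fintype.card (Plaquette d L) := by exact_mod_cast Fintype.card_pos
    positivity
  have h1 := mul_wilsonExpectation_wilsonAction_le (d := d) (L := L) ρ hρ β β'
  have h2 := mul_wilsonExpectation_wilsonAction_le (d := d) (L := L) ρ hρ β' β
  have e1 := wilsonExpectation_meanPlaquette_eq (d := d) (L := L) (G := G) ρ hρ hN β
  have e2 := wilsonExpectation_meanPlaquette_eq (d := d) (L := L) (G := G) ρ hρ hN β'
  set S1 := wilsonExpectation ρ β (wilsonAction (d := d) (L := L) (G := G) ρ)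
  set S2 := wilsonExpectation ρ β' (wilsonAction (d := d) (L := L) (G := G) ρ)
  have hS1 : S1 = N * Fintype.card (Plaquette d L) *
      (1 - wilsonExpectation ρ β (meanPlaquette (d := d) (L := L) (G := G) ρ)) := by
    rw [e1]; field_simp; ring
  have hS2 : S2 = N * Fintype.card (Plaquette d L) *
      (1 - wilsonExpectation ρ β' (meanPlaquette (d := d) (L := L) (G := G) ρ)) := by
    rw [e2]; field_simp; ring
  constructor
  · rw [hS1] at h1; nlinarith
  · rw [hS2] at h2; nlinarith


end General

section Targets

variable {N D L₀ : ℕ} {β a b : ℝ}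
/-- **Monotone transport, lower end (A17)**: a certified LOWER bound at `β_std` holds at every
larger coupling `β' ≥ β_std` (same `N, D, L₀`), because `⟨ū_P⟩` is non-decreasing in the coupling on
every torus. -/
theorem PlaquetteWindow.lower_of_le (h : PlaquetteWindow N D L₀ β a b) {β' : ℝ} (hβ : β ≤ β')
    (L : ℕ) [NeZero L] (hL : Even L) (hL₀ : L₀ ≤ L) : a ≤ plaquetteExpectation N D L β' :=
  (h L hL hL₀).1.trans (monotone_wilsonExpectation_meanPlaquette (d := D) (L := L) (suRep N)
    (continuous_suRep N) (div_le_div_of_nonneg_right hβ (Nat.cast_nonneg N)))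

/-- **Monotone transport, upper end (A17)**: a certified UPPER bound at `β_std` holds at every
smaller coupling `β' ≤ β_std`. -/
theorem PlaquetteWindow.upper_of_ge (h : PlaquetteWindow N D L₀ β a b) {β' : ℝ} (hβ : β' ≤ β)
    (L : ℕ) [NeZero L] (hL : Even L) (hL₀ : L₀ ≤ L) : plaquetteExpectation N D L β' ≤ b :=
  (monotone_wilsonExpectation_meanPlaquette (d := D) (L := L) (suRep N) (continuous_suRep N)
    (div_le_div_of_nonneg_right hβ (Nat.cast_nonneg N))).trans (h L hL hL₀).2

/-- **Consistency of a certificate family (K10)**: certified windows at `β₁ ≤ β₂` with a common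
torus in scope cannot have `b₂ < a₁`. -/
theorem PlaquetteWindow.le_of_le {β₁ β₂ a₁ b₁ a₂ b₂ : ℝ} (h₁ : PlaquetteWindow N D L₀ β₁ a₁ b₁)
    (h₂ : PlaquetteWindow N D L₀ β₂ a₂ b₂) (h12 : β₁ ≤ β₂) (L : ℕ) [NeZero L] (hL : Even L)
    (hL₀ : L₀ ≤ L) : a₁ ≤ b₂ :=
  (h₁.lower_of_le h12 L hL hL₀).trans (h₂ L hL hL₀).2

/-- **Free-energy-difference bracket (A17)**: two certified windows at `β₁, β₂` bound the
difference of torus free energies per plaquette at the tree couplings `βᵢ/N`: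
`#P·(β₂-β₁)·(a₁ - 1) ≤ log Z_L(β₂/N) - log Z_L(β₁/N) ≤ #P·(β₂-β₁)·(b₂ - 1)` for every even
`L ≥ L₀` (`#P = card (Plaquette D L) = L^D·D(D-1)/2`; `β₁ ≤ β₂`, `N ≥ 1`, `D ≥ 2`). This is a
statement at the two stated couplings, complementary to (not a substitute for) the `β → ∞`
asymptotics of Chatterjee/Brennecke. -/
theorem PlaquetteWindow.torusLogPartition_sub_mem_Icc {β₁ β₂ a₁ b₁ a₂ b₂ : ℝ}
    (h₁ : PlaquetteWindow N D L₀ β₁ a₁ b₁) (h₂ : PlaquetteWindow N D L₀ β₂ a₂ b₂) (h12 : β₁ ≤ β₂)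
    (hN : N ≠ 0) (hD : 2 ≤ D) (L : ℕ) [NeZero L] (hL : Even L) (hL₀ : L₀ ≤ L) :
    torusLogPartition D (suRep N) (β₂ / N) L - torusLogPartition D (suRep N) (β₁ / N) L ∈ Set.Icc
      ((Fintype.card (Plaquette D L) : ℝ) * (β₂ - β₁) * (a₁ - 1))
      ((Fintype.card (Plaquette D L) : ℝ) * (β₂ - β₁) * (b₂ - 1)) := by
  haveI : Nonempty (Plaquette D L) :=
    ⟨(0, ⟨(⟨0, by omega⟩, ⟨1, by omega⟩), Fin.mk_lt_mk.2 Nat.zero_lt_one⟩)⟩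
  have hN' : (N : ℝ) ≠ 0 := by exact_mod_cast hN
  have hgen := GaugeBoot.torusLogPartition_sub_mem_Icc (d := D) (L := L) (suRep N) (continuous_suRep N)
    hN (β₁ / (N : ℝ)) (β₂ / (N : ℝ))
  have hscale : (N : ℝ) * Fintype.card (Plaquette D L) * (β₂ / N - β₁ / N) =
      Fintype.card (Plaquette D L) * (β₂ - β₁) := by
    field_simp
  rw [hscale] at hgen
  have hP : (0 : ℝ) ≤ Fintype.card (Plaquette D L) * (β₂ - β₁) :=
    mul_nonneg (Nat.cast_nonneg _) (sub_nonneg.2 h12)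
  have ha := (h₁ L hL hL₀).1
  have hb := (h₂ L hL hL₀).2
  constructor
  · exact le_trans (mul_le_mul_of_nonneg_left (by unfold plaquetteExpectation at ha; linarith) hP)
      hgen.1
  · exact le_trans hgen.2
      (mul_le_mul_of_nonneg_left (by unfold plaquetteExpectation at hb; linarith) hP)

end Targets

end Summit.QuantumFields.GaugeBoot

end
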